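import Mathlib
import Literature.NumberTheory.Sieve.RoughCellDensity
import HarnessLib

/-!
# Route ParityLeakOneFifth, crux `PlainSplit` (stmt-Parity-18382), skeleton `calib-split`:
# the numerical input `I₃(5) ≤ 9/20` of stub `stub_twistedE3Upper`

`I₃(5) = roughCellDensity 3 5 = ∫₁⁴ I₂(t) dt/t = ∫₂⁴ log(t−1) dt/t = 0.4061…` is the density (in
units of `x/log x`) of the integers `≤ x` with least prime factor `≥ x^{1/5}` and exactly three
prime factors.  We certify `I₃(5) ≤ 9/20`: on each of the four pieces `[2, 5/2], [5/2, 3], [3, 7/2],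
[7/2, 4]` bound `1/t ≤ 1/a` and integrate `log(t−1)` exactly (`integral_log`), then use the upper
bounds `log(3/2) ≤ 0.406`, `log 2 ≤ 0.6931471808` (Mathlib), `log(5/2) ≤ 0.917`, `log 3 ≤ 1.0987`,
each from `k ≤ Σ_{i<n} qⁱ/i! ≤ e^q`.
-/

namespace Summit.Parity.GeneralizedHardyLittlewood.Theorems.ParityLeakOneFifth

open Real intervalIntegral
open Literature.NumberTheory.Sieve

/-- `log(3/2) ≤ 0.406`. -/
theorem log_three_halves_le : Real.log (3 / 2) ≤ 203 / 500 := by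
  rw [Real.log_le_iff_le_exp (by norm_num)]
  have h := Real.sum_le_exp_of_nonneg (show (0 : ℝ) ≤ 203 / 500 by norm_num) 5
  have e : (3 : ℝ) / 2 ≤ ∑ i ∈ Finset.range 5, ((203 : ℝ) / 500) ^ i / (i.factorial : ℝ) := by
    simp only [Finset.sum_range_succ, Finset.sum_range_zero, Nat.factorial]
    norm_num
  exact e.trans h

/-- `log(5/2) ≤ 0.917`. -/
theorem log_five_halves_le : Real.log (5 / 2) ≤ 917 / 1000 := by
  rw [Real.log_le_iff_le_exp (by norm_num)]
  have h := Real.sum_le_exp_of_nonneg (show (0 : ℝ) ≤ 917 / 1000 by norm_num) 7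
  have e : (5 : ℝ) / 2 ≤ ∑ i ∈ Finset.range 7, ((917 : ℝ) / 1000) ^ i / (i.factorial : ℝ) := by
    simp only [Finset.sum_range_succ, Finset.sum_range_zero, Nat.factorial]
    norm_num
  exact e.trans h

/-- `log 3 ≤ 1.0987`. -/
theorem log_three_le : Real.log 3 ≤ 10987 / 10000 := by
  rw [Real.log_le_iff_le_exp (by norm_num)]
  have h := Real.sum_le_exp_of_nonneg (show (0 : ℝ) ≤ 10987 / 10000 by norm_num) 9
  have e : (3 : ℝ) ≤ ∑ i ∈ Finset.range 9, ((10987 : ℝ) / 10000) ^ i / (i.factorial : ℝ) := by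
    simp only [Finset.sum_range_succ, Finset.sum_range_zero, Nat.factorial]
    norm_num
  exact e.trans h

/-- One piece: for `2 ≤ a ≤ b`,
`∫_a^b I₂(t) dt/t ≤ ((b−1)log(b−1) − (a−1)log(a−1) − (b−1) + (a−1))/a`
(`I₂(t) = log(t−1)` on `t ≥ 2`, `1/t ≤ 1/a`, `integral_log`). -/
theorem integral_roughCellDensity_two_div_le {a b : ℝ} (ha : 2 ≤ a) (hab : a ≤ b) :
    ∫ t in a..b, roughCellDensity 2 t / t ≤
      ((b - 1) * Real.log (b - 1) - (a - 1) * Real.log (a - 1) - (b - 1) + (a - 1)) / a := by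
  have ha0 : 0 < a := by linarith
  have hg : IntervalIntegrable (fun t : ℝ => Real.log (t - 1) / a) MeasureTheory.volume a b := by
    refine (ContinuousOn.div_const (ContinuousOn.log ?_ ?_) a).intervalIntegrable
    · exact continuousOn_id.sub continuousOn_const
    · intro t ht
      rw [Set.uIcc_of_le hab] at ht
      have : 2 ≤ t := ha.trans ht.1
      exact ne_of_gt (by show (0 : ℝ) < id t - 1; simp only [id]; linarith)
  have hmono : ∫ t in a..b, roughCellDensity 2 t / t ≤ ∫ t in a..b, Real.log (t - 1) / a := by
    refine intervalIntegral.integral_mono_on hab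
      (intervalIntegrable_roughCellDensity_div (by norm_num) (by linarith) (by linarith)) hg ?_
    intro t ht
    have ht2 : 2 ≤ t := ha.trans ht.1
    rw [roughCellDensity_two_of_two_le ht2]
    have hlog : 0 ≤ Real.log (t - 1) := Real.log_nonneg (by linarith)
    exact div_le_div_of_nonneg_left hlog ha0 ht.1
  refine hmono.trans (le_of_eq ?_)
  rw [intervalIntegral.integral_div, intervalIntegral.integral_comp_sub_right (fun t => Real.log t) 1,
    integral_log]

/-- **`I₃(5) ≤ 9/20`** (`I₃(5) = ∫₂⁴ log(t−1)dt/t = 0.4061…`). -/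
theorem roughCellDensity_three_five_le : roughCellDensity 3 5 ≤ 9 / 20 := by
  change roughCellDensity (2 + 1) 5 ≤ 9 / 20
  rw [roughCellDensity_succ (by norm_num), show (5 : ℝ) - 1 = 4 by norm_num]
  have hI : ∀ a b : ℝ, 1 ≤ a → 1 ≤ b →
      IntervalIntegrable (fun t : ℝ => roughCellDensity 2 t / t) MeasureTheory.volume a b :=
    fun a b ha hb => intervalIntegrable_roughCellDensity_div (by norm_num) ha hb
  -- split at 2, 5/2, 3, 7/2
  rw [← integral_add_adjacent_intervals (hI 1 2 le_rfl (by norm_num)) (hI 2 4 (by norm_num) (by norm_num)),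
    ← integral_add_adjacent_intervals (hI 2 (5 / 2) (by norm_num) (by norm_num))
      (hI (5 / 2) 4 (by norm_num) (by norm_num)),
    ← integral_add_adjacent_intervals (hI (5 / 2) 3 (by norm_num) (by norm_num))
      (hI 3 4 (by norm_num) (by norm_num)),
    ← integral_add_adjacent_intervals (hI 3 (7 / 2) (by norm_num) (by norm_num))
      (hI (7 / 2) 4 (by norm_num) (by norm_num))]
  -- the first piece vanishes
  have h0 : ∫ t in (1 : ℝ)..2, roughCellDensity 2 t / t = 0 := by
    rw [← intervalIntegral.integral_zero (a := (1 : ℝ)) (b := 2)]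
    refine intervalIntegral.integral_congr fun t ht => ?_
    rw [Set.uIcc_of_le (by norm_num : (1 : ℝ) ≤ 2)] at ht
    simp only [roughCellDensity_of_le le_rfl (by exact_mod_cast ht.2), zero_div]
  have h1 := integral_roughCellDensity_two_div_le (a := 2) (b := 5 / 2) le_rfl (by norm_num)
  have h2 := integral_roughCellDensity_two_div_le (a := 5 / 2) (b := 3) (by norm_num) (by norm_num)
  have h3 := integral_roughCellDensity_two_div_le (a := 3) (b := 7 / 2) (by norm_num) (by norm_num)
  have h4 := integral_roughCellDensity_two_div_le (a := 7 / 2) (b := 4) (by norm_num) (by norm_num)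
  norm_num at h1 h2 h3 h4
  have l15 := log_three_halves_le
  have l2 := Real.log_two_lt_d9
  have l25 := log_five_halves_le
  have l3 := log_three_le
  rw [h0]
  nlinarith [h1, h2, h3, h4, l15, l2, l25, l3]

end Summit.Parity.GeneralizedHardyLittlewood.Theorems.ParityLeakOneFifth
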